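import Summits.Ventures.YMGap.RobustBall.CentreProjectionFlux
import Summits.Ventures.YMGap.RobustBall.ZNFluxWindowPeeling
import Literature.MathematicalPhysics.QuantumFieldTheory.QuasiLocalGaugePerturbationKernels
import HarnessLib

/-!
# RobustBall/CentreProjectionWindow — centre projection for perturbations whose twist defect is a FINITE-RANGE
# flux interaction (multi-plaquette supports, vertical window `m`, transverse extent `s`): the windowed centre-tube bound
# `|⟨W_{R×T}⟩_{β,W,L}| ≤ (4 c^{⌈T/s⌉})^{#{r<R : m∣r}}`, `c = 2(d−1)N|β| + b`

HONEST FRAMING: venture file of the cell `pub-ymgap` (QuantumFields programme), track Y2 ROBUST-BALL, seat ds-4 g8.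
WHAT THIS IS: an INEQUALITY BETWEEN LATTICE EXPECTATIONS on a finite torus, the multi-plaquette sequel of
`CentreProjectionFlux`.  Twist defects of the form `W(ζ_k U) = c(U) + ∑_t g_t((curl k)|_{supp t}, U)` — finitely many
flux-local terms with plaquette supports `supp t`, `|g_t| ≤ B_t`, every support inside a vertical window (`i`-links at
cyclic `i`-distance `< m`, every `i`) and of transverse extent `≤ s` (`j`-distance `≤ s`, every `i, j`), Dobrushin defect
rows `∑_{t ∋ y} B_t (|iLinks i (supp t)| − 1) ≤ b` — NOTHING asked of the twist-invariant part `c(U)`.  Then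
(`abs_wilsonLoop_le_of_fluxDefect`) `|⟨(1/N) Re tr U_{R×T}⟩_{β,W,L}| ≤ (4 c^{⌈T/s⌉})^{#{r<R : m∣r}}` at
`c = 2(d−1)N|β| + b ≤ 1`, and in the area-law normal form `≤ 2^{2(R+T)} e^{−(−log c/(m s)) RT}`
(`windowBound_le_areaLawShape`).  Mechanism: centre projection (`CentreProjectionFlux`) with the induced `ℤ_N` theory
now carrying the Wilson plaquette weights AND the defect terms as one finite-range flux interaction (index
`Plaquette ⊕ ι`), bounded by the windowed peeling `ZNFluxW.norm_cavg_ψ_loopSum_le_window`.  Single-plaquette defects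
(`IsFluxLocal a`) are the case `m = s = 1`, `b = 2(d−1)a`.  Nothing about the continuum, a spectral gap or Clay; no
confinement claim for `SU(N)` beyond the inequality.

References for the blind mechanism AS PRINTED: J. Fröhlich, Phys. Lett. B 83 (1979) 195, Eq. (7)–(9); G. Mack,
V. B. Petkova, Ann. Phys. 123 (1979) 442, §2; the windowed peeling is Durhuus–Fröhlich 1980's.
-/

noncomputable section

open MeasureTheory Finset
open Literature.MathematicalPhysics.QuantumLattice (fundamentalRep fundamentalRep_apply continuous_fundamentalRep)
open Literature.MathematicalPhysics.QuantumFieldTheory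

namespace Summit.Ventures.YMGap.RobustBall

open ZN ZNFluxW

variable {d L N : ℕ} [NeZero L] [NeZero N] {ι : Type*} [Fintype ι]

/-! ### The induced `ℤ_N` theory: Wilson plaquette weights plus the defect terms -/

/-- Supports of the combined interaction: singletons for the Wilson plaquette weights, `supp t` for the defects. [folklore] -/
def suppS (supp : ι → Finset (Plaquette d L)) : Plaquette d L ⊕ ι → Finset (Plaquette d L) :=
  Sum.elim (fun p => {p}) supp

/-- Activities of the combined interaction in the background `U`: `β Re(ψ(φ_p) tr U_p)` and `−g_t(φ, U)`. [folklore] -/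
def gS (β : ℝ) (gD : ι → (Plaquette d L → ZMod N) → GaugeConfig d L (SUN N) → ℝ) (U : GaugeConfig d L (SUN N)) :
    Plaquette d L ⊕ ι → (Plaquette d L → ZMod N) → ℝ :=
  Sum.elim (fun p φ => β * (ψ N (φ p) * ((plaquetteHolonomy U p.1 p.2.1.1 p.2.1.2 : SUN N) :
      Matrix (Fin N) (Fin N) ℂ).trace).re)
    (fun t φ => -gD t φ U)

/-- Bounds of the combined interaction: `A` (`= |β| N`) for plaquettes, `B t` for defects. [folklore] -/
def BS (A : ℝ) (B : ι → ℝ) : Plaquette d L ⊕ ι → ℝ := Sum.elim (fun _ => A) B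

/-- **The `ℤ_N` Wilson loop of the induced theory with the combined finite-range flux interaction.** [folklore] -/
def znLoopW (β : ℝ) (gD : ι → (Plaquette d L → ZMod N) → GaugeConfig d L (SUN N) → ℝ) (U : GaugeConfig d L (SUN N))
    (x : Site d L) (i j : Fin d) (R T : ℕ) : ℂ :=
  FiniteGibbs.cavg (znWD (gS β gD U)) fun k => ψ N (loopSum k x i j R T)

omit [NeZero L] [Fintype ι] in
/-- The `i`-links of a singleton support are the plaquette's `iSites`. [folklore] -/
theorem iLinks_singleton (i : Fin d) (p : Plaquette d L) : iLinks i ({p} : Finset (Plaquette d L)) = iSites i p := by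
  simp [iLinks]

omit [NeZero L] [NeZero N] [Fintype ι] in
/-- Two `i`-sites of one plaquette sit at the same `i`-height. [folklore] -/
theorem iDist_eq_zero_of_mem_iSites (i : Fin d) (p : Plaquette d L) {y y' : Site d L} (hy : y ∈ iSites i p)
    (hy' : y' ∈ iSites i p) : (y i - y' i).valMinAbs.natAbs = 0 := by
  rw [apply_eq_of_mem_iSites i p hy, apply_eq_of_mem_iSites i p hy', sub_self, ZMod.valMinAbs_zero, Int.natAbs_zero]

omit [NeZero N] [Fintype ι] in
/-- Two `i`-sites of one plaquette are at `j`-distance `≤ 1`. [folklore] -/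
theorem jDist_le_one_of_mem_iSites (i j : Fin d) (p : Plaquette d L) {y y' : Site d L} (hy : y ∈ iSites i p)
    (hy' : y' ∈ iSites i p) : jDist j y' y ≤ 1 := by
  have h := jDist_le_of_mem_iSites i j y' p hy hy'
  rwa [jDist_self, zero_add] at h

/-- **The induced `ℤ_N` Wilson loop with a finite-range flux defect obeys the windowed area-law bound**
`‖znLoopW‖ ≤ (4 c^{⌈T/s⌉})^{#{r<R : m∣r}}` at `c = 2(d−1)N|β| + b ≤ 1` (`N ≥ 2`, `0 < m`, `0 < s`, `2R, 2T ≤ L`). [folklore] -/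
theorem norm_znLoopW_le (hN : 2 ≤ N) (β : ℝ) {supp : ι → Finset (Plaquette d L)}
    {gD : ι → (Plaquette d L → ZMod N) → GaugeConfig d L (SUN N) → ℝ} {B : ι → ℝ}
    (hdep : ∀ t U, DependsOn (fun φ => gD t φ U) (↑(supp t) : Set (Plaquette d L))) (hB0 : ∀ t, 0 ≤ B t)
    (hB : ∀ t φ U, |gD t φ U| ≤ B t) {m : ℕ} (hm : 0 < m)
    (hwin : ∀ t (i : Fin d), ∀ y ∈ iLinks i (supp t), ∀ y' ∈ iLinks i (supp t), (y i - y' i).valMinAbs.natAbs < m)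
    {s : ℕ} (hs : 0 < s) (hext : ∀ t (i j : Fin d), ∀ y ∈ iLinks i (supp t), ∀ y' ∈ iLinks i (supp t), jDist j y' y ≤ s)
    {b : ℝ} (hrowD : ∀ (i : Fin d) (y : Site d L), ∑ t ∈ Finset.univ.filter (fun t => y ∈ iLinks i (supp t)),
      B t * (((iLinks i (supp t)).card : ℝ) - 1) ≤ b)
    {c : ℝ} (hc : 2 * ((d - 1 : ℕ) : ℝ) * |β| * N + b ≤ c) (hc1 : c ≤ 1) (U : GaugeConfig d L (SUN N)) (x : Site d L)
    {i j : Fin d} (hij : i ≠ j) {R T : ℕ} (hR : 2 * R ≤ L) (hT : 2 * T ≤ L) :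
    ‖znLoopW β gD U x i j R T‖ ≤ (4 * c ^ ((T + s - 1) / s)) ^ (selIdx m R).card := by
  classical
  refine norm_cavg_ψ_loopSum_le_window hN (supp := suppS supp) (g := gS β gD U) (B := BS (d := d) (L := L) (|β| * N) B) ?_ ?_ ?_ hij
    (m := m) ?_ ?_ hc1 hs ?_ x hR hT
  · rintro (p | t)
    · intro φ φ' h
      simp only [gS, Sum.elim_inl]
      rw [h p (by simp [suppS])]
    · intro φ φ' h
      have e : gD t φ U = gD t φ' U := hdep t U h
      simp only [gS, Sum.elim_inr, e]
  · rintro (p | t)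
    · exact mul_nonneg (abs_nonneg β) (Nat.cast_nonneg N)
    · exact hB0 t
  · rintro (p | t) φ
    · simp only [gS, BS, Sum.elim_inl]
      rw [abs_mul]
      refine mul_le_mul_of_nonneg_left ((Complex.abs_re_le_norm _).trans ?_) (abs_nonneg β)
      rw [norm_mul, norm_ψ, one_mul]; exact norm_trace_le _
    · simp only [gS, BS, Sum.elim_inr, abs_neg]; exact hB t φ U
  · rintro (p | t) y hy y' hy'
    · simp only [suppS, Sum.elim_inl, iLinks_singleton] at hy hy'
      rw [iDist_eq_zero_of_mem_iSites i p hy hy']; exact hm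
    · exact hwin t i y hy y' hy'
  · -- row sums: Wilson part `≤ 2(d−1)|β|N`, defect part `≤ b`
    intro y
    rw [Finset.sum_filter, Fintype.sum_sum_type]
    have hW : ∑ p : Plaquette d L, (if y ∈ iLinks i (suppS supp (Sum.inl p)) then
        BS (d := d) (L := L) (|β| * N) B (Sum.inl p) * (((iLinks i (suppS supp (Sum.inl p))).card : ℝ) - 1) else 0) ≤
        2 * ((d - 1 : ℕ) : ℝ) * |β| * N := by
      simp only [suppS, BS, Sum.elim_inl, iLinks_singleton]
      calc ∑ p : Plaquette d L, (if y ∈ iSites i p then |β| * N * (((iSites i p).card : ℝ) - 1) else 0)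
          ≤ ∑ p : Plaquette d L, (if y ∈ iSites i p then |β| * N else 0) := by
            refine Finset.sum_le_sum fun p _ => ?_
            split_ifs with hp
            · have h2 : ((iSites i p).card : ℝ) ≤ 2 := by exact_mod_cast card_iSites_le i p
              have h0 : 0 ≤ |β| * (N : ℝ) := mul_nonneg (abs_nonneg β) (Nat.cast_nonneg N)
              nlinarith
            · exact le_rfl
        _ = |β| * N * (((Finset.univ : Finset (Plaquette d L)).filter fun p => y ∈ iSites i p).card : ℝ) := by
            rw [← Finset.sum_filter, Finset.sum_const, nsmul_eq_mul, mul_comm]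
        _ ≤ |β| * N * (2 * (d - 1) : ℕ) := by
            refine mul_le_mul_of_nonneg_left ?_ (mul_nonneg (abs_nonneg β) (Nat.cast_nonneg N))
            exact_mod_cast card_filter_mem_iSites_le i y
        _ = 2 * ((d - 1 : ℕ) : ℝ) * |β| * N := by push_cast; ring
    have hD : ∑ t : ι, (if y ∈ iLinks i (suppS supp (Sum.inr t)) then
        BS (d := d) (L := L) (|β| * N) B (Sum.inr t) * (((iLinks i (suppS supp (Sum.inr t))).card : ℝ) - 1) else 0) ≤ b := by
      simp only [suppS, BS, Sum.elim_inr]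
      rw [← Finset.sum_filter]; exact hrowD i y
    linarith
  · rintro (p | t) y hy y' hy'
    · simp only [suppS, Sum.elim_inl, iLinks_singleton] at hy hy'
      exact (jDist_le_one_of_mem_iSites i j p hy hy').trans hs
    · exact hext t i j y hy y' hy'

/-! ### The centre-projection bound with a finite-range flux defect -/

/-- **THE CENTRE-PROJECTION BOUND, FINITE-RANGE DEFECT FORM.**  For EVERY perturbation `W` of the `SU(N)` Wilson action
whose twist defect is a finite-range flux interaction, `W(ζ_k U) = c(U) + ∑_t g_t((curl k), U)` (no smallness, range or
window asked of the twist-invariant part `c`), and every uniform bound `M` on the Wilson loop of the induced `ℤ_N` gauge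
theory (Wilson plaquette weights plus the defect terms) over all backgrounds `U`: `|⟨(1/N) Re tr U_{∂R×T}⟩_{β,W,L}| ≤ M`.
HONEST LABEL: an inequality between lattice expectations; `M` is supplied by `norm_znLoopW_le`. [cite: Frohlich1979ZN, Eq. (7)–(9)] -/
theorem abs_expectation_wilsonLoop_le_of_fluxDefect (W : Perturbation d L N) {c : GaugeConfig d L (SUN N) → ℝ}
    {gD : ι → (Plaquette d L → ZMod N) → GaugeConfig d L (SUN N) → ℝ}
    (hW : ∀ (k : Edge d L → ZMod N) (U : GaugeConfig d L (SUN N)),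
      W.total (twistOf k * U) = c U + ∑ t, gD t (flux k) U)
    (β : ℝ) (x : Site d L) (i j : Fin d) (R T : ℕ) {M : ℝ}
    (hM : ∀ U : GaugeConfig d L (SUN N), ‖znLoopW β gD U x i j R T‖ ≤ M) :
    |W.expectation (fundamentalRep (Fin N)) β (wilsonLoop (fundamentalRep (Fin N)) x i j R T)| ≤ M := by
  set ρ := fundamentalRep (Fin N) with hρdef
  have hρ : Continuous ρ := continuous_fundamentalRep (Fin N)
  set π : Measure (GaugeConfig d L (SUN N)) := Measure.pi fun _ : Edge d L => haarProbability (SUN N) with hπ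
  haveI : IsProbabilityMeasure π := by rw [hπ]; infer_instance
  set E : GaugeConfig d L (SUN N) → ℝ := fun U => -β * wilsonAction ρ U - W.total U with hE
  have hEm : Measurable E := QuasiLocalGaugePerturbation.measurable_action ρ hρ β W
  obtain ⟨CE, hCE⟩ := QuasiLocalGaugePerturbation.exists_abs_action_le ρ hρ β W
  have hexp_m : Measurable fun U => Real.exp (E U) := Real.measurable_exp.comp hEm
  have hexp_bd : ∀ U, ‖Real.exp (E U)‖ ≤ Real.exp CE := fun U => by
    rw [Real.norm_eq_abs, abs_of_pos (Real.exp_pos _)]; exact Real.exp_le_exp.2 (le_of_abs_le (hCE U))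
  have hexp_int : Integrable (fun U => Real.exp (E U)) π :=
    Integrable.of_bound hexp_m.aestronglyMeasurable (Real.exp CE) (Filter.Eventually.of_forall hexp_bd)
  have hZpos : 0 < ∫ U, Real.exp (E U) ∂π := integral_exp_pos hexp_int
  set lt := loopTrace (N := N) x i j R T with hlt
  have hlt_m : Measurable lt := (continuous_loopTrace x i j R T).measurable
  set g₁ : GaugeConfig d L (SUN N) → ℂ := fun U => (Real.exp (E U) : ℂ) * lt U with hg₁
  have hexp_eq : W.expectation ρ β (wilsonLoop ρ x i j R T) =
      (∫ U, Real.exp (E U) * wilsonLoop ρ x i j R T U ∂π) / ∫ U, Real.exp (E U) ∂π := by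
    rw [QuasiLocalGaugePerturbation.expectation, QuasiLocalGaugePerturbation.perturbedMeasure_eq_tilted ρ hρ β W,
      ← hπ, integral_tilted]
    simp only [smul_eq_mul]
    rw [← integral_div]
    exact integral_congr_ae (Filter.Eventually.of_forall fun U => by ring)
  have hg₁_int : Integrable g₁ π := by
    refine Integrable.of_bound ((Complex.measurable_ofReal.comp hexp_m).mul hlt_m).aestronglyMeasurable
      (Real.exp CE) (Filter.Eventually.of_forall fun U => ?_)
    rw [hg₁]; dsimp only
    rw [norm_mul, Complex.norm_real]
    calc ‖Real.exp (E U)‖ * ‖lt U‖ ≤ Real.exp CE * 1 :=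
          mul_le_mul (hexp_bd U) (norm_loopTrace_le_one x i j R T U) (norm_nonneg _) (Real.exp_pos _).le
      _ = Real.exp CE := mul_one _
  have hre : ∫ U, Real.exp (E U) * wilsonLoop ρ x i j R T U ∂π = (∫ U, g₁ U ∂π).re := by
    have h := integral_re hg₁_int
    simp only [RCLike.re_to_complex] at h
    rw [← h]
    refine integral_congr_ae (Filter.Eventually.of_forall fun U => ?_)
    show Real.exp (E U) * wilsonLoop ρ x i j R T U = ((Real.exp (E U) : ℂ) * lt U).re
    rw [Complex.re_ofReal_mul, hlt, wilsonLoop_eq_re_loopTrace]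
  -- the energy of a twisted configuration: Wilson fluxes plus the defect terms = the combined interaction
  set P := Fintype.card (Plaquette d L) with hP
  set K := Fintype.card (Edge d L → ZMod N) with hK
  have hK0 : (0 : ℝ) < K := by rw [hK]; exact_mod_cast Fintype.card_pos
  have hEtwist : ∀ (k : Edge d L → ZMod N) (U : GaugeConfig d L (SUN N)),
      E (twistOf k * U) = (-β * ((N : ℝ) * P) - c U) + ∑ t', gS β gD U t' (flux k) := by
    intro k U
    simp only [hE]
    rw [wilsonAction_twist_eq, hW k U, Fintype.sum_sum_type]
    simp only [gS, Sum.elim_inl, Sum.elim_inr, Finset.sum_neg_distrib]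
    unfold twistEnergy flux
    rw [← Finset.mul_sum]
    ring
  set G : GaugeConfig d L (SUN N) → ℝ := fun U =>
    (K : ℝ)⁻¹ * (Real.exp (-β * ((N : ℝ) * P) - c U) * FiniteGibbs.mass (znWD (gS β gD U))) with hG
  have hmassU : ∀ U, 0 < FiniteGibbs.mass (znWD (N := N) (L := L) (gS β gD U)) := fun U =>
    FiniteGibbs.mass_pos_of_pos (znWD_pos _)
  have hG0 : ∀ U, 0 ≤ G U := fun U =>
    mul_nonneg (inv_nonneg.2 hK0.le) (mul_nonneg (Real.exp_pos _).le (hmassU U).le)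
  have hsum₀ : ∀ U, (K : ℝ)⁻¹ • ∑ k : Edge d L → ZMod N, Real.exp (E (twistOf k * U)) = G U := by
    intro U
    simp only [hEtwist, Real.exp_add, ← Finset.mul_sum, smul_eq_mul, hG, FiniteGibbs.mass, znWD]
  have hsum₁ : ∀ U, (K : ℝ)⁻¹ • ∑ k : Edge d L → ZMod N, g₁ (twistOf k * U) =
      (G U : ℂ) * (lt U * znLoopW β gD U x i j R T) := by
    intro U
    have hm : (FiniteGibbs.mass (znWD (gS β gD U)) : ℂ) ≠ 0 := by
      rw [Ne, Complex.ofReal_eq_zero]; exact (hmassU U).ne'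
    simp only [hg₁, hlt, loopTrace_twist, hEtwist, Real.exp_add, Complex.ofReal_mul]
    have hfac : ∑ k : Edge d L → ZMod N, (Real.exp (-β * ((N : ℝ) * P) - c U) : ℂ) *
        (Real.exp (∑ t', gS β gD U t' (flux k)) : ℂ) * (ψ N (loopSum k x i j R T) * loopTrace x i j R T U) =
        (Real.exp (-β * ((N : ℝ) * P) - c U) : ℂ) * loopTrace x i j R T U *
          ∑ k : Edge d L → ZMod N, (znWD (gS β gD U) k : ℂ) * ψ N (loopSum k x i j R T) := by
      rw [Finset.mul_sum]
      refine Finset.sum_congr rfl fun k _ => ?_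
      rw [znWD]; ring
    rw [hfac, znLoopW, FiniteGibbs.cavg, hG, Complex.real_smul]
    push_cast
    field_simp
  have hZ : ∫ U, Real.exp (E U) ∂π = ∫ U, G U ∂π := by
    rw [integral_eq_avg_twist (fun U => Real.exp (E U)) fun k => ?_]
    · exact integral_congr_ae (Filter.Eventually.of_forall hsum₀)
    · exact (measurePreserving_twistEquiv k).integrable_comp_emb (twistEquiv k).measurableEmbedding |>.2 hexp_int
  have hN₁ : ∫ U, g₁ U ∂π = ∫ U, (G U : ℂ) * (lt U * znLoopW β gD U x i j R T) ∂π := by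
    rw [integral_eq_avg_twist g₁ fun k => ?_]
    · exact integral_congr_ae (Filter.Eventually.of_forall hsum₁)
    · exact (measurePreserving_twistEquiv k).integrable_comp_emb (twistEquiv k).measurableEmbedding |>.2 hg₁_int
  have hGint : Integrable G π := by
    have h1 : Integrable (fun U => ∑ k : Edge d L → ZMod N, Real.exp (E (twistOf k * U))) π :=
      integrable_finsetSum Finset.univ fun k _ =>
        (measurePreserving_twistEquiv k).integrable_comp_emb (twistEquiv k).measurableEmbedding |>.2 hexp_int
    refine (integrable_congr (Filter.Eventually.of_forall fun U => ?_)).1 (h1.smul ((K : ℝ)⁻¹))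
    show (K : ℝ)⁻¹ • ∑ k : Edge d L → ZMod N, Real.exp (E (twistOf k * U)) = G U
    exact hsum₀ U
  have hbound : ‖∫ U, g₁ U ∂π‖ ≤ M * ∫ U, Real.exp (E U) ∂π := by
    rw [hN₁, hZ, ← integral_const_mul]
    refine (norm_integral_le_integral_norm _).trans (integral_mono_of_nonneg
      (Filter.Eventually.of_forall fun U => norm_nonneg _) (hGint.const_mul M)
      (Filter.Eventually.of_forall fun U => ?_))
    show ‖(G U : ℂ) * (lt U * znLoopW β gD U x i j R T)‖ ≤ M * G U
    rw [norm_mul, Complex.norm_real, Real.norm_eq_abs, abs_of_nonneg (hG0 U), norm_mul, mul_comm]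
    refine mul_le_mul_of_nonneg_right ?_ (hG0 U)
    calc ‖lt U‖ * ‖znLoopW β gD U x i j R T‖ ≤ 1 * M :=
          mul_le_mul (norm_loopTrace_le_one x i j R T U) (hM U) (norm_nonneg _) zero_le_one
      _ = M := one_mul M
  rw [hexp_eq, hre, abs_div, abs_of_pos hZpos, div_le_iff₀ hZpos]
  exact (Complex.abs_re_le_norm _).trans hbound

/-- **THE WINDOWED CENTRE-TUBE BOUND**: `N ≥ 2`; a twist defect that is a finite-range flux interaction with plaquette
supports inside a vertical window `m ≥ 1` and of transverse extent `≤ s` (`s ≥ 1`), bounds `|g_t| ≤ B_t`, defect rows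
`≤ b`; `c = 2(d−1)N|β| + b ≤ 1`, `i ≠ j`, `2R, 2T ≤ L` ⇒
`|⟨(1/N) Re tr U_{R×T}⟩_{β,W,L}| ≤ (4 c^{⌈T/s⌉})^{#{r<R : m∣r}}`. [folklore] -/
theorem abs_wilsonLoop_le_of_fluxDefect (hN : 2 ≤ N) {β : ℝ} (W : Perturbation d L N)
    {c₀ : GaugeConfig d L (SUN N) → ℝ} {supp : ι → Finset (Plaquette d L)}
    {gD : ι → (Plaquette d L → ZMod N) → GaugeConfig d L (SUN N) → ℝ} {B : ι → ℝ}
    (hW : ∀ (k : Edge d L → ZMod N) (U : GaugeConfig d L (SUN N)), W.total (twistOf k * U) = c₀ U + ∑ t, gD t (flux k) U)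
    (hdep : ∀ t U, DependsOn (fun φ => gD t φ U) (↑(supp t) : Set (Plaquette d L))) (hB0 : ∀ t, 0 ≤ B t)
    (hB : ∀ t φ U, |gD t φ U| ≤ B t) {m : ℕ} (hm : 0 < m)
    (hwin : ∀ t (i : Fin d), ∀ y ∈ iLinks i (supp t), ∀ y' ∈ iLinks i (supp t), (y i - y' i).valMinAbs.natAbs < m)
    {s : ℕ} (hs : 0 < s) (hext : ∀ t (i j : Fin d), ∀ y ∈ iLinks i (supp t), ∀ y' ∈ iLinks i (supp t), jDist j y' y ≤ s)
    {b : ℝ} (hrowD : ∀ (i : Fin d) (y : Site d L), ∑ t ∈ Finset.univ.filter (fun t => y ∈ iLinks i (supp t)),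
      B t * (((iLinks i (supp t)).card : ℝ) - 1) ≤ b)
    {c : ℝ} (hc : 2 * ((d - 1 : ℕ) : ℝ) * |β| * N + b ≤ c) (hc1 : c ≤ 1) (x : Site d L) {i j : Fin d} (hij : i ≠ j)
    {R T : ℕ} (hR : 2 * R ≤ L) (hT : 2 * T ≤ L) :
    |W.expectation (fundamentalRep (Fin N)) β (wilsonLoop (fundamentalRep (Fin N)) x i j R T)| ≤
      (4 * c ^ ((T + s - 1) / s)) ^ (selIdx m R).card :=
  abs_expectation_wilsonLoop_le_of_fluxDefect W hW β x i j R T fun U =>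
    norm_znLoopW_le hN β hdep hB0 hB hm hwin hs hext hrowD hc hc1 U x hij hR hT

/-! ### The windowed bound in the area-law normal form -/

/-- `(4 c^{⌈T/s⌉})^{#{r<R : m∣r}} ≤ 2^{2(R+T)} · e^{(log c/(m s)) RT}` for `0 < c ≤ 1`, `0 < m`, `0 < s`: the windowed
bound in the shape `C^{2(R+T)} e^{−c' RT}` with `C = 2`, `c' = −log c/(m s)`. [folklore] -/
theorem windowBound_le_areaLawShape {c : ℝ} (hc0 : 0 < c) (hc1 : c ≤ 1) {m s : ℕ} (hm : 0 < m) (hs : 0 < s) (R T : ℕ) :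
    (4 * c ^ ((T + s - 1) / s)) ^ (selIdx m R).card ≤
      (2 : ℝ) ^ (2 * (R + T)) * Real.exp (-(-Real.log c / (m * s)) * ((R : ℝ) * T)) := by
  set n := (selIdx m R).card with hn
  set a := (T + s - 1) / s with ha
  have hnR : n ≤ R := card_selIdx_le m R
  have hRn : (R : ℝ) ≤ m * n := by exact_mod_cast le_mul_card_selIdx hm R
  have hTa : (T : ℝ) ≤ s * a := by
    have h := Nat.lt_div_mul_add (a := T + s - 1) hs
    have : T ≤ s * a := by rw [ha, mul_comm]; omega
    exact_mod_cast this
  have hlog : Real.log c ≤ 0 := Real.log_nonpos hc0.le hc1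
  -- the power of `c`
  have e1 : (c ^ a) ^ n = Real.exp (((a * n : ℕ) : ℝ) * Real.log c) := by
    rw [← pow_mul, ← Real.exp_log (pow_pos hc0 _), Real.log_pow]
  have hexp : (c ^ a) ^ n ≤ Real.exp (-(-Real.log c / (m * s)) * ((R : ℝ) * T)) := by
    rw [e1, Real.exp_le_exp]
    have hms : (0 : ℝ) < m * s := by positivity
    -- `a n log c ≤ (R T/(m s)) log c` since `R T ≤ (m n)(s a)` and `log c ≤ 0`
    have hRT : (R : ℝ) * T ≤ (m * n) * (s * a) :=
      mul_le_mul hRn hTa (Nat.cast_nonneg T) (by positivity)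
    have hq : (R : ℝ) * T / (m * s) ≤ ((a * n : ℕ) : ℝ) := by
      rw [div_le_iff₀ hms]; push_cast; nlinarith [hRT]
    calc ((a * n : ℕ) : ℝ) * Real.log c ≤ ((R : ℝ) * T / (m * s)) * Real.log c :=
          mul_le_mul_of_nonpos_right hq hlog
      _ = -(-Real.log c / (m * s)) * ((R : ℝ) * T) := by ring
  have e3 : (2 : ℝ) ^ (2 * (R + T)) = 4 ^ (R + T) := by rw [pow_mul]; norm_num
  rw [mul_pow, e3]
  exact mul_le_mul (pow_le_pow_right₀ (by norm_num) (hnR.trans (Nat.le_add_right R T))) hexp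
    (pow_nonneg (pow_nonneg hc0.le _) _) (pow_nonneg (by norm_num) _)

end Summit.Ventures.YMGap.RobustBall

end
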